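import Summits.AnomalousDissipation.AnomalousDissipation.Theses.TaylorCertificates
import Summits.AnomalousDissipation.AnomalousDissipation.Theorems.TaylorCertificatePair.Negative.Modes
import Literature.Analysis.FunctionSpaces.TorusFluidGlueProofs

/-!
# The Taylor–Green pattern force is a designer force (crux `SmoothEulerCoerciveForce`, negative side)

Crux `TaylorCertificates.SmoothEulerCoerciveForce` (stmt-AnomalousDissipation-14097), cdisprove seat
`refuter-cdisprove-stmt-AnomalousDissipation-14097-0`.

Certified Lamb-vector bookkeeping for the Taylor–Green vortex `U = (sin X cos Y cos Z, −cos X sin Y cos Z, 0)`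
(unit torus, `X = 2πx₁` etc.): `(U·∇)U = ¼(sin 2X, sin 2Y, 0)(1 + cos 2Z)`, whose Leray projection is
`F_TG = ⅛(sin 2X cos 2Z, sin 2Y cos 2Z, −sin 2Z (cos 2X + cos 2Y))` — on the unit torus the weak identity reads
`∫ ⟪(U·∇)U − 2π F_TG, w⟫ = 0` for every smooth divergence-free `w`.  In real modes:
`U = ∑ₘ Re(e_{K m} • Z m)`, `K = ![(1,1,1),(1,1,−1),(1,−1,1),(1,−1,−1)]`, `Z = −(i/4)·![(1,−1,0),(1,−1,0),(1,1,0),(1,1,0)]`;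
`2π F_TG = ∑ₘ Re(e_{KF m} • Y m)`, `KF = ![(2,0,2),(2,0,−2),(0,2,2),(0,2,−2)]`,
`Y = −(iπ/8)·![(1,0,−1),(1,0,1),(0,1,−1),(0,1,1)]`.
Consequences: `taylorGreen_not_witness` — the Taylor–Green pattern force (the hub cards' `F_TG`, cards
lamb-syzygy-taylor-green-circle / mixed-sector-taylor-green-coercive-candidate) satisfies the force hypotheses
of the crux and FAILS its `∀ v` clause at the smooth, divergence-free, mean-zero `U`; with `Negative/Translate`
every translate (in particular the mixed-sector force `F⁽⁺⁻⁾ = F_TG(· + (0,¼,0))`) is excluded as well.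
Template: `Negative/TwoBeltramiDodger.lean`.  No definitions; no statement of the route is asserted.
-/

noncomputable section

open MeasureTheory UnitAddTorus Matrix
open scoped InnerProductSpace ComplexConjugate

namespace Summit.AnomalousDissipation.AnomalousDissipation.Theorems.SmoothEulerCoerciveForce.Negative

open Literature.Analysis.FunctionSpaces
open Summit.AnomalousDissipation.AnomalousDissipation.Theorems.TaylorCertificatePair.Negative

/-- **Weak identity `∫ ⟪(U·∇)U − 2πF_TG, w⟫ = 0`** for the Taylor–Green vortex `U` and every smooth divergence-free
test field `w` (data passed as variables pinned by equations). -/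
theorem taylorGreen_quiet {K KF : Fin 4 → Fin 3 → ℤ} {Zp YF : Fin 4 → EuclideanSpace ℂ (Fin 3)}
    (hK : K = ![![1, 1, 1], ![1, 1, -1], ![1, -1, 1], ![1, -1, -1]])
    (hZp : Zp = ![WithLp.toLp 2 ![-Complex.I / 4, Complex.I / 4, 0], WithLp.toLp 2 ![-Complex.I / 4, Complex.I / 4, 0],
      WithLp.toLp 2 ![-Complex.I / 4, -Complex.I / 4, 0], WithLp.toLp 2 ![-Complex.I / 4, -Complex.I / 4, 0]])
    (hKF : KF = ![![2, 0, 2], ![2, 0, -2], ![0, 2, 2], ![0, 2, -2]])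
    (hYF : YF = ![WithLp.toLp 2 ![-(Real.pi : ℂ) * Complex.I / 8, 0, (Real.pi : ℂ) * Complex.I / 8],
      WithLp.toLp 2 ![-(Real.pi : ℂ) * Complex.I / 8, 0, -(Real.pi : ℂ) * Complex.I / 8],
      WithLp.toLp 2 ![0, -(Real.pi : ℂ) * Complex.I / 8, (Real.pi : ℂ) * Complex.I / 8],
      WithLp.toLp 2 ![0, -(Real.pi : ℂ) * Complex.I / 8, -(Real.pi : ℂ) * Complex.I / 8]])
    (w : UnitAddTorus (Fin 3) → EuclideanSpace ℝ (Fin 3)) (hws : Torus.IsSmooth w) (hwd : Torus.IsDivFree w) :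
    ∫ x, ⟪Torus.convect (∑ mm, Torus.realTrigPoly {K mm} (fun _ => Zp mm))
        (∑ mm, Torus.realTrigPoly {K mm} (fun _ => Zp mm)) x -
        (∑ mm, Torus.realTrigPoly {KF mm} (fun _ => YF mm)) x, w x⟫_ℝ = 0 := by
  have hZp' : ∀ m, ((fun j => ((K m) j : ℂ)) ⬝ᵥ (WithLp.ofLp (Zp m))) = 0 := by
    intro m; fin_cases m <;> simp [hK, hZp, dotProduct, Fin.sum_univ_three] <;> ring
  have hvs : Torus.IsSmooth (∑ mm, Torus.realTrigPoly {K mm} (fun _ => Zp mm)) := isSmooth_modes K Zp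
  have hvd : Torus.IsDivFree (∑ mm, Torus.realTrigPoly {K mm} (fun _ => Zp mm)) := isDivFree_modes K Zp hZp'
  have hfs : Torus.IsSmooth (∑ mm, Torus.realTrigPoly {KF mm} (fun _ => YF mm)) := isSmooth_modes KF YF
  have hwi : Integrable w volume := hws.integrable
  have h1 : Integrable (fun x => ⟪Torus.convect (∑ mm, Torus.realTrigPoly {K mm} (fun _ => Zp mm))
      (∑ mm, Torus.realTrigPoly {K mm} (fun _ => Zp mm)) x, w x⟫_ℝ) volume :=
    ((hvs.convect hvs).inner hws).integrable
  have h2 : Integrable (fun x => ⟪(∑ mm, Torus.realTrigPoly {KF mm} (fun _ => YF mm)) x, w x⟫_ℝ) volume :=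
    (hfs.inner hws).integrable
  simp_rw [inner_sub_left]
  rw [integral_sub h1 h2]
  rw [Torus.integral_inner_convect_eq_neg hvs hvd hvs hws]
  have hcomm : ∫ x, ⟪(∑ mm, Torus.realTrigPoly {K mm} (fun _ => Zp mm)) x,
        Torus.convect (∑ mm, Torus.realTrigPoly {K mm} (fun _ => Zp mm)) w x⟫_ℝ =
      ∫ x, ⟪Torus.fderiv w x ((∑ mm, Torus.realTrigPoly {K mm} (fun _ => Zp mm)) x),
        (∑ mm, Torus.realTrigPoly {K mm} (fun _ => Zp mm)) x⟫_ℝ :=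
    integral_congr_ae (ae_of_all _ fun x => real_inner_comm _ _)
  rw [hcomm, inertial_modes hws]
  have hf : ∫ x, ⟪(∑ mm, Torus.realTrigPoly {KF mm} (fun _ => YF mm)) x, w x⟫_ℝ =
      ∑ m, (⟪YF m, mFourierCoeff (EuclideanSpace.complexify ∘ w) (KF m)⟫_ℂ).re := by
    simp_rw [modes_apply, sum_inner]
    rw [integral_finsetSum _ fun m _ =>
      ((continuous_mode _ _).inner hws.continuous).integrable_unitAddTorus]
    exact Finset.sum_congr rfl fun m _ => integral_inner_mode_left hwi _ _
  rw [hf]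
  -- frequency bookkeeping: six representatives `KF 0..3`, `P = K 0 + K 3 = (2,0,0)`, `Q = K 0 - K 2 = (0,2,0)`
  have ef0 : KF 0 = K 0 + K 2 := by funext i; fin_cases i <;> simp [hK, hKF]
  have ef1 : KF 1 = K 1 + K 3 := by funext i; fin_cases i <;> simp [hK, hKF]
  have ef2 : KF 2 = K 0 - K 3 := by funext i; fin_cases i <;> simp [hK, hKF]
  have ef3 : KF 3 = K 1 - K 2 := by funext i; fin_cases i <;> simp [hK, hKF]
  have e1 : K 2 + K 0 = K 0 + K 2 := add_comm _ _
  have e2 : K 3 + K 1 = K 1 + K 3 := add_comm _ _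
  have e3 : K 3 - K 0 = -(K 0 - K 3) := (neg_sub _ _).symm
  have e4 : K 2 - K 1 = -(K 1 - K 2) := (neg_sub _ _).symm
  have e5 : K 3 + K 0 = K 0 + K 3 := add_comm _ _
  have e6 : K 1 + K 2 = K 0 + K 3 := by funext i; fin_cases i <;> simp [hK]
  have e7 : K 2 + K 1 = K 0 + K 3 := by funext i; fin_cases i <;> simp [hK]
  have e8 : K 1 - K 3 = K 0 - K 2 := by funext i; fin_cases i <;> simp [hK]
  have e9 : K 2 - K 0 = -(K 0 - K 2) := (neg_sub _ _).symm
  have e10 : K 3 - K 1 = -(K 0 - K 2) := by funext i; fin_cases i <;> simp [hK]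
  have hcsC : mFourierCoeff (EuclideanSpace.complexify ∘ w) (-(K 0 - K 3)) =
      EuclideanSpace.conjVec (mFourierCoeff (EuclideanSpace.complexify ∘ w) (K 0 - K 3)) :=
    Torus.isConjSymm_mFourierCoeff hwi _
  have hcsD : mFourierCoeff (EuclideanSpace.complexify ∘ w) (-(K 1 - K 2)) =
      EuclideanSpace.conjVec (mFourierCoeff (EuclideanSpace.complexify ∘ w) (K 1 - K 2)) :=
    Torus.isConjSymm_mFourierCoeff hwi _
  have hcsF : mFourierCoeff (EuclideanSpace.complexify ∘ w) (-(K 0 - K 2)) =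
      EuclideanSpace.conjVec (mFourierCoeff (EuclideanSpace.complexify ∘ w) (K 0 - K 2)) :=
    Torus.isConjSymm_mFourierCoeff hwi _
  have htA := hwd.sum_mul_mFourierCoeff_eq_zero hws (K 0 + K 2)
  have htB := hwd.sum_mul_mFourierCoeff_eq_zero hws (K 1 + K 3)
  have htC := hwd.sum_mul_mFourierCoeff_eq_zero hws (K 0 - K 3)
  have htD := hwd.sum_mul_mFourierCoeff_eq_zero hws (K 1 - K 2)
  have htE := hwd.sum_mul_mFourierCoeff_eq_zero hws (K 0 + K 3)
  have htF := hwd.sum_mul_mFourierCoeff_eq_zero hws (K 0 - K 2)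
  simp only [Fin.sum_univ_four]
  rw [ef0, ef1, ef2, ef3, e1, e2, e3, e4, e5, e6, e7, e8, e9, e10, hcsC, hcsD, hcsF]
  set A := mFourierCoeff (EuclideanSpace.complexify ∘ w) (K 0 + K 2) with hA
  set B := mFourierCoeff (EuclideanSpace.complexify ∘ w) (K 1 + K 3) with hB
  set C := mFourierCoeff (EuclideanSpace.complexify ∘ w) (K 0 - K 3) with hC
  set D := mFourierCoeff (EuclideanSpace.complexify ∘ w) (K 1 - K 2) with hD
  set E := mFourierCoeff (EuclideanSpace.complexify ∘ w) (K 0 + K 3) with hE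
  set F := mFourierCoeff (EuclideanSpace.complexify ∘ w) (K 0 - K 2) with hF
  clear_value A B C D E F
  subst hK hZp hKF hYF
  simp only [Fin.sum_univ_three, Matrix.cons_val, Pi.add_apply, Pi.sub_apply] at htA htB htC htD htE htF
  simp only [dotProduct, Fin.sum_univ_three, Pi.add_apply, Pi.sub_apply, Pi.neg_apply, Matrix.cons_val,
    PiLp.inner_apply, RCLike.inner_apply, EuclideanSpace.conjVec_apply]
  simp only [Int.cast_add, Int.cast_sub, Int.cast_neg, Int.cast_one] at htA htB htC htD htE htF ⊢
  have hA2 : A 2 = -A 0 := by linear_combination htA / 2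
  have hB2 : B 2 = B 0 := by linear_combination -htB / 2
  have hC2 : C 2 = -C 1 := by linear_combination htC / 2
  have hD2 : D 2 = D 1 := by linear_combination -htD / 2
  have hE0 : E 0 = 0 := by linear_combination htE / 2
  have hF1 : F 1 = 0 := by linear_combination htF / 2
  simp only [hA2, hB2, hC2, hD2, hE0, hF1, map_neg, map_zero, Complex.conj_conj]
  simp [Complex.mul_re, Complex.mul_im, Complex.conj_re, Complex.conj_im, Complex.div_re, Complex.div_im]
  ring

/-- **The Taylor–Green pattern force `2π F_TG` is not a witness of the crux**: it is smooth, divergence free and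
mean zero, and the `∀ v` clause FAILS at the smooth, divergence-free, MEAN-ZERO Taylor–Green vortex `U`. -/
theorem taylorGreen_not_witness :
    Torus.IsSmooth (∑ mm, Torus.realTrigPoly {(![![2, 0, 2], ![2, 0, -2], ![0, 2, 2], ![0, 2, -2]] : Fin 4 → Fin 3 → ℤ) mm}
        (fun _ => (![WithLp.toLp 2 ![-(Real.pi : ℂ) * Complex.I / 8, 0, (Real.pi : ℂ) * Complex.I / 8],
          WithLp.toLp 2 ![-(Real.pi : ℂ) * Complex.I / 8, 0, -(Real.pi : ℂ) * Complex.I / 8],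
          WithLp.toLp 2 ![0, -(Real.pi : ℂ) * Complex.I / 8, (Real.pi : ℂ) * Complex.I / 8],
          WithLp.toLp 2 ![0, -(Real.pi : ℂ) * Complex.I / 8, -(Real.pi : ℂ) * Complex.I / 8]] :
            Fin 4 → EuclideanSpace ℂ (Fin 3)) mm)) ∧
    Torus.IsDivFree (∑ mm, Torus.realTrigPoly {(![![2, 0, 2], ![2, 0, -2], ![0, 2, 2], ![0, 2, -2]] : Fin 4 → Fin 3 → ℤ) mm}
        (fun _ => (![WithLp.toLp 2 ![-(Real.pi : ℂ) * Complex.I / 8, 0, (Real.pi : ℂ) * Complex.I / 8],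
          WithLp.toLp 2 ![-(Real.pi : ℂ) * Complex.I / 8, 0, -(Real.pi : ℂ) * Complex.I / 8],
          WithLp.toLp 2 ![0, -(Real.pi : ℂ) * Complex.I / 8, (Real.pi : ℂ) * Complex.I / 8],
          WithLp.toLp 2 ![0, -(Real.pi : ℂ) * Complex.I / 8, -(Real.pi : ℂ) * Complex.I / 8]] :
            Fin 4 → EuclideanSpace ℂ (Fin 3)) mm)) ∧
    Torus.HasZeroMean (∑ mm, Torus.realTrigPoly {(![![2, 0, 2], ![2, 0, -2], ![0, 2, 2], ![0, 2, -2]] : Fin 4 → Fin 3 → ℤ) mm}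
        (fun _ => (![WithLp.toLp 2 ![-(Real.pi : ℂ) * Complex.I / 8, 0, (Real.pi : ℂ) * Complex.I / 8],
          WithLp.toLp 2 ![-(Real.pi : ℂ) * Complex.I / 8, 0, -(Real.pi : ℂ) * Complex.I / 8],
          WithLp.toLp 2 ![0, -(Real.pi : ℂ) * Complex.I / 8, (Real.pi : ℂ) * Complex.I / 8],
          WithLp.toLp 2 ![0, -(Real.pi : ℂ) * Complex.I / 8, -(Real.pi : ℂ) * Complex.I / 8]] :
            Fin 4 → EuclideanSpace ℂ (Fin 3)) mm)) ∧
    ¬ (∀ v : UnitAddTorus (Fin 3) → EuclideanSpace ℝ (Fin 3), Torus.IsSmooth v → Torus.IsDivFree v →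
          Torus.HasZeroMean v →
          (∀ w : UnitAddTorus (Fin 3) → EuclideanSpace ℝ (Fin 3), Torus.IsSmooth w → Torus.IsDivFree w →
            Torus.HasZeroMean w →
            ∫ x, ⟪Torus.convect v v x -
              (∑ mm, Torus.realTrigPoly {(![![2, 0, 2], ![2, 0, -2], ![0, 2, 2], ![0, 2, -2]] : Fin 4 → Fin 3 → ℤ) mm}
                (fun _ => (![WithLp.toLp 2 ![-(Real.pi : ℂ) * Complex.I / 8, 0, (Real.pi : ℂ) * Complex.I / 8],
                  WithLp.toLp 2 ![-(Real.pi : ℂ) * Complex.I / 8, 0, -(Real.pi : ℂ) * Complex.I / 8],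
                  WithLp.toLp 2 ![0, -(Real.pi : ℂ) * Complex.I / 8, (Real.pi : ℂ) * Complex.I / 8],
                  WithLp.toLp 2 ![0, -(Real.pi : ℂ) * Complex.I / 8, -(Real.pi : ℂ) * Complex.I / 8]] :
                    Fin 4 → EuclideanSpace ℂ (Fin 3)) mm)) x,
              w x⟫_ℝ = 0) → False) := by
  have hKF0 : ∀ m, (![![2, 0, 2], ![2, 0, -2], ![0, 2, 2], ![0, 2, -2]] : Fin 4 → Fin 3 → ℤ) m ≠ 0 := by
    intro m h
    fin_cases m
    · have := congrFun h 2; simp at this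
    · have := congrFun h 2; simp at this
    · have := congrFun h 2; simp at this
    · have := congrFun h 2; simp at this
  have hK0 : ∀ m, (![![1, 1, 1], ![1, 1, -1], ![1, -1, 1], ![1, -1, -1]] : Fin 4 → Fin 3 → ℤ) m ≠ 0 := by
    intro m h
    fin_cases m
    · have := congrFun h 0; simp at this
    · have := congrFun h 0; simp at this
    · have := congrFun h 0; simp at this
    · have := congrFun h 0; simp at this
  have hY' : ∀ m, ((fun j => (((![![2, 0, 2], ![2, 0, -2], ![0, 2, 2], ![0, 2, -2]] : Fin 4 → Fin 3 → ℤ) m) j : ℂ)) ⬝ᵥ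
      (WithLp.ofLp ((![WithLp.toLp 2 ![-(Real.pi : ℂ) * Complex.I / 8, 0, (Real.pi : ℂ) * Complex.I / 8],
          WithLp.toLp 2 ![-(Real.pi : ℂ) * Complex.I / 8, 0, -(Real.pi : ℂ) * Complex.I / 8],
          WithLp.toLp 2 ![0, -(Real.pi : ℂ) * Complex.I / 8, (Real.pi : ℂ) * Complex.I / 8],
          WithLp.toLp 2 ![0, -(Real.pi : ℂ) * Complex.I / 8, -(Real.pi : ℂ) * Complex.I / 8]] :
            Fin 4 → EuclideanSpace ℂ (Fin 3)) m))) = 0 := by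
    intro m; fin_cases m <;> simp [dotProduct, Fin.sum_univ_three] <;> ring
  have hZ' : ∀ m, ((fun j => (((![![1, 1, 1], ![1, 1, -1], ![1, -1, 1], ![1, -1, -1]] : Fin 4 → Fin 3 → ℤ) m) j : ℂ)) ⬝ᵥ
      (WithLp.ofLp ((![WithLp.toLp 2 ![-Complex.I / 4, Complex.I / 4, 0], WithLp.toLp 2 ![-Complex.I / 4, Complex.I / 4, 0],
        WithLp.toLp 2 ![-Complex.I / 4, -Complex.I / 4, 0], WithLp.toLp 2 ![-Complex.I / 4, -Complex.I / 4, 0]] :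
          Fin 4 → EuclideanSpace ℂ (Fin 3)) m))) = 0 := by
    intro m; fin_cases m <;> simp [dotProduct, Fin.sum_univ_three] <;> ring
  refine ⟨isSmooth_modes _ _, isDivFree_modes _ _ hY', hasZeroMean_modes _ _ hKF0, fun h => ?_⟩
  exact h _ (isSmooth_modes _ _) (isDivFree_modes _ _ hZ') (hasZeroMean_modes _ _ hK0)
    fun w hws hwd _ => taylorGreen_quiet rfl rfl rfl rfl w hws hwd

end Summit.AnomalousDissipation.AnomalousDissipation.Theorems.SmoothEulerCoerciveForce.Negative
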